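import Summits.ABC.IUTFork.Cor312Ind3IteratesVacuityWild
import Literature.IUT.LogVolume.UnitLogWildQuartic
import HarnessLib

/-!
# [IUTchIII] Thm 3.11 (ii) (Ind3), honest model: depth `≥ 2` is EMPTY again at places with `e(v|3) = 4`
# (abc-iut cell, wave-5 seat abc-iut-w5-d172, gen 2; record-only, D-0012)

S. Mochizuki, *Inter-universal Teichmüller theory III*, kurims manuscript (May 2020), Prop. 3.5 (ii) (a)(b)
pp. 104–105, Rmk. 1.1.1 (i) p. 28 [claim: Mochizuki2012, status: disputed].

Third leaf of the (Ind3) non-vacuity census of abc-iut-w4-d029's honest model of the log-link iterates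
(`Cor312Ind3RealIterates`, p412330) for the ANALYTIC logarithms (`Real.analyticLogv`, abc-iut-c312-5):
* p414009 `Real.nonarchIterImage_add_two_eq_empty`: depth `≥ 2` EMPTY wherever `e(v|p_v) ≤ p_v − 1`;
* p419392 `Real.nonarchIterImage_analyticLogv_two_nonempty_of_cube`: depth `2` INHABITED at every `v | 3` whose
  completion contains a cube root of `3` (`e = p_v = 3`: the threshold is sharp);
* THIS FILE: depth `≥ 2` EMPTY at every `v | 3` with `e(v|3) = 4` — although `e = 4 > p_v − 1 = 2`.  So vacuity
  of the deep (Ind3) clauses is NOT a function of `e(v|p_v)` versus `p_v` alone; the exact per-place criterion is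
  p415013's «no `log_v(u)` is a unit».  Classical input: `Literature.IUT.LogVolume.WildQuartic.
  norm_unitLog_ne_one_of_absRamificationIdx_eq_four` (`e(K/ℚ₃) = 4 ⇒ ‖log₃ u‖ ≠ 1`, Neukirch ANT II (5.5):
  `‖log₃ u‖ ∈ {3^{1/4}} ∪ [0, 3^{−1/2}]`), transported through abc-iut-S7's rescaled completion
  (`absRamificationIdx_rescaledCompletion`).

* `Real.analyticLogv_ne_coe_unit_of_ramificationIdx_eq_four`, **`Real.nonarchIterImage_add_two_eq_empty_of_
  ramificationIdx_eq_four`** (+ `_of_two_le`), `Real.not_ramificationIdx_le_of_ramificationIdx_eq_four` (the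
  hypothesis of p414009 indeed FAILS there), and the column-level
  `Column.unitImage_add_two_eq_empty_of_honestImages_of_ramificationIdx_eq_four`.

Honest framing: statements ABOUT THE MODEL; nothing here asserts or denies [IUTchIII] Cor. 3.12 or takes a
side; typed ≠ proved; instantiated ≠ endorsed.  No definitions, no Prop-valued fact (D-0067 (1)).  (A number
field with such a place, e.g. `ℚ(∜3)`, is classical; its ramification computation is not formalised here —
the local hypothesis class `e = 4` is shown inhabited in `UnitLogWildQuartic.exists_absRamificationIdx_eq_four`.)
-/

noncomputable section

open Set

namespace Summit.ABC.IUTFork.Thm311.Real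

open NumberField IsDedekindDomain Literature.IUT.LogVolume Literature.IUT.LogThetaLattice
  Literature.NumberTheory.NumberFields

variable {F : Type} [Field F] [NumberField F]

/-- In the rescaled completion at a place over `p = 3` with `e(v|3) = 4`, no `unitLog` value has norm `1`
(`WildQuartic.norm_unitLog_ne_one_of_absRamificationIdx_eq_four` + abc-iut-S7's
`absRamificationIdx_rescaledCompletion`); stated over a prime `p = 3` so that it applies verbatim to the `p_v` of
`Real.analyticLogv_apply`. [cite: NeukirchANT1999, Ch. II (5.5)] -/
theorem norm_rescaled_unitLog_ne_one_of_ramificationIdx_eq_four (v : HeightOneSpectrum (𝓞 F)) (p : ℕ)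
    [Fact p.Prime] (hv : ((p : ℕ) : 𝓞 F) ∈ v.asIdeal) (hp3 : p = 3) (he : v.asIdeal.ramificationIdx ℤ = 4)
    (x : RescaledCompletion F p v hv) : ‖unitLog x‖ ≠ 1 := by
  subst hp3
  have he' : absRamificationIdx 3 (RescaledCompletion F 3 v hv) = 4 := by
    rw [absRamificationIdx_rescaledCompletion, he]
  exact WildQuartic.norm_unitLog_ne_one_of_absRamificationIdx_eq_four he' x

/-- **At a finite place `v | 3` with `e(v|3) = 4`, the analytic logarithm of a unit is never a unit of `O_v`.**
[cite: NeukirchANT1999, Ch. II (5.5)] -/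
theorem analyticLogv_ne_coe_unit_of_ramificationIdx_eq_four (v : HeightOneSpectrum (𝓞 F))
    (h3 : ((3 : ℕ) : 𝓞 F) ∈ v.asIdeal) (he : v.asIdeal.ramificationIdx ℤ = 4) (w u : (↥(integers v))ˣ) :
    analyticLogv F v (Additive.ofMul w) ≠ ((u : ↥(integers v)) : Carrier (.inr v : Place F)) := by
  haveI : Fact (residueChar F v).Prime := ⟨residueChar_prime F v⟩
  have hp : residueChar F v = 3 := residueChar_eq_of_prime_natCast_mem v Nat.prime_three h3
  intro h
  have h1 : ‖RescaledCompletion.of F (residueChar F v) v (natCast_residueChar_mem F v)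
      (analyticLogv F v (Additive.ofMul w))‖ ≠ 1 := by
    rw [analyticLogv_apply, RingEquiv.apply_symm_apply]
    exact norm_rescaled_unitLog_ne_one_of_ramificationIdx_eq_four v (residueChar F v)
      (natCast_residueChar_mem F v) hp he _
  rw [h] at h1
  exact h1 (norm_of_coe_unit_adicCompletionIntegers F (residueChar F v) v (natCast_residueChar_mem F v) u)

/-- **Depth `≥ 2` is EMPTY at every finite place `v | 3` with `e(v|3) = 4`** — although `e = 4 > p_v − 1`, so
p414009 does not apply: the vacuity of the deep (Ind3) clauses is not detected by `e` versus `p_v` alone.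
[claim: Mochizuki2012, status: disputed] -/
theorem nonarchIterImage_add_two_eq_empty_of_ramificationIdx_eq_four (v : HeightOneSpectrum (𝓞 F))
    (h3 : ((3 : ℕ) : 𝓞 F) ∈ v.asIdeal) (he : v.asIdeal.ramificationIdx ℤ = 4) (k : ℕ) :
    nonarchIterImage (analyticLogv F) v (k + 2) = ∅ :=
  nonarchIterImage_add_two_eq_empty_of_forall_ne (analyticLogv F) v
    (fun w u => analyticLogv_ne_coe_unit_of_ramificationIdx_eq_four v h3 he w u) k

/-- … for every depth `m′ ≥ 2`. [claim: Mochizuki2012, status: disputed] -/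
theorem nonarchIterImage_eq_empty_of_two_le_of_ramificationIdx_eq_four (v : HeightOneSpectrum (𝓞 F))
    (h3 : ((3 : ℕ) : 𝓞 F) ∈ v.asIdeal) (he : v.asIdeal.ramificationIdx ℤ = 4) {m' : ℕ} (hm' : 2 ≤ m') :
    nonarchIterImage (analyticLogv F) v m' = ∅ := by
  obtain ⟨k, rfl⟩ := Nat.exists_eq_add_of_le' hm'
  exact nonarchIterImage_add_two_eq_empty_of_ramificationIdx_eq_four v h3 he k

omit [NumberField F] in
/-- The hypothesis `e(v|p_v) ≤ p_v − 1` of p414009 indeed FAILS at such a place (`4 ≤ 2` is false), so this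
vacuity is NOT an instance of p414009. [folklore] -/
theorem not_ramificationIdx_le_of_ramificationIdx_eq_four (v : HeightOneSpectrum (𝓞 F))
    (h3 : ((3 : ℕ) : 𝓞 F) ∈ v.asIdeal) (he : v.asIdeal.ramificationIdx ℤ = 4) :
    ¬ v.asIdeal.ramificationIdx ℤ ≤ residueChar F v - 1 := by
  rw [he, residueChar_eq_of_prime_natCast_mem v Nat.prime_three h3]
  omega

/-- **Column level.** For pilot data `X` and ANY column over `Real.logShellsDH X (analyticLogv F)` with honest
unit images (abc-iut-w4-d029's `hunit`): if some place `w` of `F` over `v_ℚ` has `3 ∈ 𝔭_w` and `e(w|3) = 4`,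
the unit image at `(m, m′ + 2, j, v_ℚ)` is `∅` (one empty tensor factor). [claim: Mochizuki2012, status: disputed] -/
theorem _root_.Summit.ABC.IUTFork.Thm311.Column.unitImage_add_two_eq_empty_of_honestImages_of_ramificationIdx_eq_four
    (X : PilotData F) (C : Column (logShellsDH X (analyticLogv F)))
    (hunit : ∀ (m : ℤ) (m' : ℕ) (j : (thetaIndex X).Label) (vQ : (thetaIndex X).VQ),
      C.unitImage m m' j vQ =
        (logShellsDH X (analyticLogv F)).tprodImages j vQ (honestU X (analyticLogv F) m m' vQ))
    (m : ℤ) (k : ℕ) (j : (thetaIndex X).Label) {vQ : (thetaIndex X).VQ}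
    (w : HeightOneSpectrum (𝓞 F)) (hw : (thetaIndex X).over (.inr w) = vQ)
    (h3 : ((3 : ℕ) : 𝓞 F) ∈ w.asIdeal) (he : w.asIdeal.ramificationIdx ℤ = 4) :
    C.unitImage m (k + 2) j vQ = ∅ := by
  rw [hunit]
  exact LogShells.tprodImages_eq_empty_of_eq_empty _ j vQ _ ⟨.inr w, hw⟩
    (nonarchIterImage_add_two_eq_empty_of_ramificationIdx_eq_four w h3 he k)

end Summit.ABC.IUTFork.Thm311.Real

end
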